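import Mathlib

/-!
# Amplitude floor from an upper bound on the saturating response

Solo-blind programme (AnomalousDissipation), steady-door line, §24.17 (g-vii)/(8″) of the working paper.

The reduced steady pattern equation balances the supercriticality `ΔK > 0` of the columnar
instability against the reduction of the leaf growth exponent produced by the pattern's own
mean flow: schematically `R(q) = ΔK`, where `q ≥ 0` is the squared amplitude and `R` the
(nonlinear) response.  The numerical comparison with full Navier–Stokes (s37) shows that the
true response is STRONGER than its linearisation `ℓ q` at the amplitudes reached.  The lemmas
below record the elementary but load-bearing consequence: a stronger *monotone-type* response
lowers the equilibrium amplitude but cannot destroy it — an upper envelope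
`R(q) ≤ ℓ q (1 + θ q)` with `ℓ > 0`, `θ ≥ 0` forces `q ≥ (ΔK/ℓ) / (1 + θ ΔK/ℓ)`, hence a positive
floor; only a response strength `ℓ` diverging along the sequence can send the amplitude to zero.
Conversely a lower envelope `ℓ q ≤ R(q)` caps the amplitude by the linear prediction `ΔK/ℓ`.
-/

namespace Summit.AnomalousDissipation.AnomalousDissipation.Theorems

/-- The quadratic envelope `g(q) = ℓ q (1 + θ q)` evaluated at `q₀ = (ΔK/ℓ)/(1 + θ ΔK/ℓ)` does not
exceed `ΔK` (because `(1 + x)² ≥ 1 + 2x`). -/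
theorem envelope_at_floor_le (ℓ θ ΔK : ℝ) (hℓ : 0 < ℓ) (hθ : 0 ≤ θ) (hΔ : 0 ≤ ΔK) :
    ℓ * (ΔK / ℓ / (1 + θ * (ΔK / ℓ))) * (1 + θ * (ΔK / ℓ / (1 + θ * (ΔK / ℓ)))) ≤ ΔK := by
  set a := ΔK / ℓ with ha_def
  have ha : 0 ≤ a := div_nonneg hΔ hℓ.le
  set x := θ * a with hx_def
  have hx : 0 ≤ x := mul_nonneg hθ ha
  have h1 : 0 < 1 + x := by linarith
  have hΔ' : ΔK = ℓ * a := by rw [ha_def]; field_simp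
  -- rewrite the left side as ℓ a (1 + x + x) / (1 + x)^2... more precisely ℓ a (1 + 2x)/(1+x)^2
  have key : ℓ * (a / (1 + x)) * (1 + θ * (a / (1 + x))) = ℓ * a * ((1 + 2 * x) / (1 + x) ^ 2) := by
    field_simp
    ring
  rw [key, hΔ']
  have hfrac : (1 + 2 * x) / (1 + x) ^ 2 ≤ 1 := by
    rw [div_le_one (by positivity)]
    nlinarith
  have hℓa : 0 ≤ ℓ * a := mul_nonneg hℓ.le ha
  calc ℓ * a * ((1 + 2 * x) / (1 + x) ^ 2) ≤ ℓ * a * 1 :=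
        mul_le_mul_of_nonneg_left hfrac hℓa
    _ = ℓ * a := mul_one _

/-- The quadratic envelope `q ↦ ℓ q (1 + θ q)` is strictly increasing on `[0, ∞)`. -/
theorem envelope_strictMonoOn (ℓ θ : ℝ) (hℓ : 0 < ℓ) (hθ : 0 ≤ θ) :
    StrictMonoOn (fun q : ℝ => ℓ * q * (1 + θ * q)) (Set.Ici 0) := by
  intro p hp q hq hpq
  simp only [Set.mem_Ici] at hp hq
  have : ℓ * p * (1 + θ * p) < ℓ * q * (1 + θ * q) := by
    have h1 : ℓ * p < ℓ * q := mul_lt_mul_of_pos_left hpq hℓ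
    have h2 : 1 + θ * p ≤ 1 + θ * q := by nlinarith
    have h3 : 0 < 1 + θ * p := by nlinarith
    calc ℓ * p * (1 + θ * p) < ℓ * q * (1 + θ * p) := mul_lt_mul_of_pos_right h1 h3
      _ ≤ ℓ * q * (1 + θ * q) := by
          apply mul_le_mul_of_nonneg_left h2
          exact mul_nonneg hℓ.le hq
  exact this

/-- **Amplitude floor.** If the equilibrium `R = ΔK` is reached at a squared amplitude `q ≥ 0`
and the response obeys the upper envelope `R ≤ ℓ q (1 + θ q)` (`ℓ > 0`, `θ ≥ 0`), then
`q ≥ (ΔK/ℓ)/(1 + θ ΔK/ℓ)`: a stronger-than-linear saturating response lowers the amplitude at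
most by the factor `1 + θ ΔK/ℓ`. -/
theorem amplitude_floor_of_response_envelope (ℓ θ ΔK q R : ℝ) (hℓ : 0 < ℓ) (hθ : 0 ≤ θ)
    (hΔ : 0 ≤ ΔK) (hq : 0 ≤ q) (hR : R ≤ ℓ * q * (1 + θ * q)) (hbal : R = ΔK) :
    ΔK / ℓ / (1 + θ * (ΔK / ℓ)) ≤ q := by
  set q₀ := ΔK / ℓ / (1 + θ * (ΔK / ℓ)) with hq₀
  have hq₀nn : 0 ≤ q₀ := by
    apply div_nonneg (div_nonneg hΔ hℓ.le)
    have : 0 ≤ θ * (ΔK / ℓ) := mul_nonneg hθ (div_nonneg hΔ hℓ.le)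
    linarith
  rcases le_or_gt q₀ q with hge | hlt
  · exact hge
  exfalso
  have hmono := envelope_strictMonoOn ℓ θ hℓ hθ
  have hlt' : ℓ * q * (1 + θ * q) < ℓ * q₀ * (1 + θ * q₀) :=
    hmono (Set.mem_Ici.mpr hq) (Set.mem_Ici.mpr hq₀nn) hlt
  have henv := envelope_at_floor_le ℓ θ ΔK hℓ hθ hΔ
  -- ΔK = R ≤ g(q) < g(q₀) ≤ ΔK : contradiction
  have : ΔK < ΔK := by
    calc ΔK = R := hbal.symm
      _ ≤ ℓ * q * (1 + θ * q) := hR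
      _ < ℓ * q₀ * (1 + θ * q₀) := hlt'
      _ ≤ ΔK := henv
  exact lt_irrefl _ this

/-- **Amplitude cap.** If the response is at least linear, `ℓ q ≤ R`, then the equilibrium
amplitude is at most the linear prediction `ΔK/ℓ`. -/
theorem amplitude_le_linear_of_response_lower (ℓ ΔK q R : ℝ) (hℓ : 0 < ℓ)
    (hR : ℓ * q ≤ R) (hbal : R = ΔK) : q ≤ ΔK / ℓ := by
  rw [le_div_iff₀ hℓ]
  linarith [hR, hbal]

/-- **Dissipation floor.** With energy weight `e > 0` and viscosity parameter `K₀ > 0` the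
anomalous dissipation of the pattern `D = 2 K₀ e q` inherits the floor:
`D ≥ 2 K₀ e (ΔK/ℓ)/(1 + θ ΔK/ℓ) > 0` whenever `ΔK > 0`. -/
theorem dissipation_floor_of_response_envelope (ℓ θ ΔK q R K₀ e : ℝ) (hℓ : 0 < ℓ)
    (hθ : 0 ≤ θ) (hΔ : 0 < ΔK) (hq : 0 ≤ q) (hK : 0 < K₀) (he : 0 < e)
    (hR : R ≤ ℓ * q * (1 + θ * q)) (hbal : R = ΔK) :
    0 < 2 * K₀ * e * (ΔK / ℓ / (1 + θ * (ΔK / ℓ))) ∧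
      2 * K₀ * e * (ΔK / ℓ / (1 + θ * (ΔK / ℓ))) ≤ 2 * K₀ * e * q := by
  have hfloor := amplitude_floor_of_response_envelope ℓ θ ΔK q R hℓ hθ hΔ.le hq hR hbal
  have hpos : 0 < ΔK / ℓ / (1 + θ * (ΔK / ℓ)) := by
    apply div_pos (div_pos hΔ hℓ)
    have : 0 ≤ θ * (ΔK / ℓ) := mul_nonneg hθ (div_pos hΔ hℓ).le
    linarith
  refine ⟨by positivity, ?_⟩
  exact mul_le_mul_of_nonneg_left hfloor (by positivity)

/-- **Only a diverging response strength kills the floor.** Along a sequence of problems with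
common supercriticality `ΔK > 0`, envelopes `R_j ≤ ℓ_j q_j (1 + θ_j q_j)` and UNIFORM bounds
`ℓ_j ≤ L`, `θ_j ≤ Θ`, every equilibrium amplitude is bounded below by the single constant
`(ΔK/L)/(1 + Θ ΔK/ℓ_min)`-type quantity; here in the clean form with `ℓ_j ≤ L` and `θ_j ≤ Θ`:
`q_j ≥ (ΔK/L)/(1 + Θ ΔK/m)` for any `0 < m ≤ ℓ_j`. -/
theorem uniform_amplitude_floor (ℓ θ ΔK q R L Θ m : ℝ) (hm : 0 < m) (hmℓ : m ≤ ℓ) (hℓL : ℓ ≤ L)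
    (hθ : 0 ≤ θ) (hθΘ : θ ≤ Θ) (hΔ : 0 < ΔK) (hq : 0 ≤ q)
    (hR : R ≤ ℓ * q * (1 + θ * q)) (hbal : R = ΔK) :
    ΔK / L / (1 + Θ * (ΔK / m)) ≤ q := by
  have hℓ : 0 < ℓ := lt_of_lt_of_le hm hmℓ
  have hL : 0 < L := lt_of_lt_of_le hℓ hℓL
  have hfloor := amplitude_floor_of_response_envelope ℓ θ ΔK q R hℓ hθ hΔ.le hq hR hbal
  refine le_trans ?_ hfloor
  -- (ΔK/L)/(1 + Θ ΔK/m) ≤ (ΔK/ℓ)/(1 + θ ΔK/ℓ): numerator smaller, denominator larger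
  have hnum : ΔK / L ≤ ΔK / ℓ := div_le_div_of_nonneg_left hΔ.le hℓ hℓL
  have hden : 1 + θ * (ΔK / ℓ) ≤ 1 + Θ * (ΔK / m) := by
    have h1 : ΔK / ℓ ≤ ΔK / m := div_le_div_of_nonneg_left hΔ.le hm hmℓ
    have h2 : θ * (ΔK / ℓ) ≤ Θ * (ΔK / m) :=
      mul_le_mul hθΘ h1 (div_nonneg hΔ.le hℓ.le) (le_trans hθ hθΘ)
    linarith
  have hdenpos : 0 < 1 + θ * (ΔK / ℓ) := by
    have : 0 ≤ θ * (ΔK / ℓ) := mul_nonneg hθ (div_nonneg hΔ.le hℓ.le); linarith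
  calc ΔK / L / (1 + Θ * (ΔK / m)) ≤ ΔK / ℓ / (1 + Θ * (ΔK / m)) := by
        apply div_le_div_of_nonneg_right hnum
        exact le_trans hdenpos.le hden
    _ ≤ ΔK / ℓ / (1 + θ * (ΔK / ℓ)) :=
        div_le_div_of_nonneg_left (div_nonneg hΔ.le hℓ.le) hdenpos hden

end Summit.AnomalousDissipation.AnomalousDissipation.Theorems
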